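import Literature.Geometry.Kaehler.ApproxHermitianYangMills
import Literature.Geometry.Kaehler.NearlyHolomorphicCycleSupport
import HarnessLib

/-!
# Asymptotically holomorphic sequences of sections and estimated transversality (Donaldson–Auroux)

Layer `Literature/Geometry/Kaehler`. Requested by route `HodgeConjecture/HolomorphicityRate`
(crux `AHGlobalisationWithRate`, item `stmt-HodgeConjecture-18023`) for its lines: over the landed
carriers `SmoothHermitianBundle E M` (a `C^∞` Hermitian vector bundle with its atlas of frames,
`ApproxHermitianYangMills.lean`), `UnitaryConnection` (unitary connections by their connection
forms `θ_{x₀}` in the frames of the atlas) and the twists `F ⊗ L^k`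
(`SmoothHermitianBundle.tensorLinePow`, `SmoothHermitianBundleTensor.lean`), and a Riemannian
metric `g` on the real tangent bundle of the complex manifold `M`:

1. sections `s : Π x, B.V x` of a `C^∞` Hermitian bundle `B` read in the frames of the atlas
   (`SmoothHermitianBundle.inFrame x₀ s : M → B.Fiber`, the coordinate column `u` of `s = s_{x₀} u`
   — Kobayashi I.(1.1)), their regularity (`IsContMDiffSection n s`: every `u` is real-`Cⁿ` on its
   frame domain), the covariant derivative `∇_D s` of a section for a unitary connection `D`, in the
   frame at `x₀`: `D u = du + θ_{x₀} u` (`SmoothHermitianBundle.covDeriv`; the formula of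
   `HermitianHolomorphicBundle.covDeriv`, Kobayashi III.(1.1)), its parts of type `(1,0)` and
   `(0,1)` for the complex structure `J = tangentJ` of `M`: `∂_D s = ½(∇s - i ∇s ∘ J)`,
   `∂̄_D s = ½(∇s + i ∇s ∘ J)` ([McDuffSalamon2017, §7.4, pp. 328–329]: "`∂s := ½(Ds - iDs∘J)`,
   `∂̄s := ½(Ds + iDs∘J)` … the complex linear and complex anti-linear parts of `Ds`"; here
   `MForm.oneZeroPart` / `MForm.zeroOnePart` of a `1`-form with values in a complex space, of which
   the tree's `dPrime` / `dDoublePrime` are the case `∇ = d`), and the POINTWISE, frame-free objects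
   `∇s(x), ∂s(x), ∂̄s(x) : T_x M →ₗ[ℝ] B.V x` (`nablaAt`, `delAt`, `delbarAt`: computed in the
   frame of the atlas at `x` itself and mapped back to the fibre by that frame) with the squared
   `h`-norm `hnormSq x w = h(w, w)` of fibre vectors;
2. **Donaldson's asymptotic holomorphicity with a rate** (`IsAsymptoticallyHolomorphicSequence`):
   for a sequence of `C^∞` Hermitian bundles `B k` (intended `F ⊗ L^k`) with unitary connections
   `D k`, a metric `g`, a RATE `ε : ℕ → ℝ` and sections `s k` of `B k`, the bounds of
   [Auroux1997, Def. 1] — there for `ε_k = k^{-1/2}`: "`|s_k| = O(1)`, `|∇s_k| = O(k^{1/2})`,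
   `|∂̄s_k| = O(1)`, `|∇∇s_k| = O(k)`, `|∇∂̄s_k| = O(k^{1/2})`" in the norms of `g` and `h`, i.e.,
   in the norms of the rescaled metrics `g_k = k·g`: `|s_k| ≤ C`, `|∇s_k|_{g_k} ≤ C`,
   `|∂̄s_k|_{g_k} ≤ C ε_k`, `|∇∇s_k|_{g_k} ≤ C`, `|∇∂̄s_k|_{g_k} ≤ C ε_k` for all large `k` (after
   [Donaldson1996, §1], the case of line bundles);
3. **estimated (`η`-)transversality** (`IsEtaTransverse`, `IsUniformlyTransverseSequence`),
   [Auroux1997, Def. 2]: "`s` is `η`-transverse to `0` if whenever `|s(x)| < η`, the covariant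
   derivative `∇s(x) : T_x X → (E ⊗ L^k)_x` is surjective and admits a right inverse whose norm is
   smaller than `η⁻¹ k^{-1/2}`" (`= η⁻¹` for `g_k`); "a family of sections is transverse to `0` if
   there exists an `η > 0` such that `η`-transversality to `0` holds for all large values of `k`";
4. API towards [Auroux1997, Prop. 1] ("the zero sets `W_k` of `s_k` are embedded symplectic
   submanifolds … asymptotically `J`-holomorphic, i.e. `J(TW_k)` is within `O(k^{-1/2})` of
   `TW_k`"; [McDuffSalamon2017, Lemma 7.4.2]; [Donaldson1996, §1]) in the currency of
   `NearlyHolomorphicCycleSupport.lean`: the linear algebra `∇_{Jv}s = i∂_v s - i∂̄_v s`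
   (`nablaAt_tangentJ`), whence on `ker ∇s(x)`, `∇_{Jv} s = -2i ∂̄_v s`, and the ANGLE ESTIMATE
   `hasJDefectLE_ker_nablaAt`: a right inverse of `∇s(x)` of `g_k → h` norm `≤ η⁻¹` and
   `|∂̄s(x)|_{g_k → h} ≤ b` give `HasJDefectLE g x (2b/η) (ker ∇s(x))` — for an asymptotically
   holomorphic, uniformly transverse sequence the tangent spaces `T_x Z(s_k) = ker ∇s_k(x)` of the
   zero sets have `J`-defect `≤ 2Cε_k/η` (`IsAsymptoticallyHolomorphicSequence.hasJDefectLE_ker`),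
   the defect clause of `IsNearlyHolomorphicRegularPoint` / `IsNearlyHolomorphicCycleSupport … ∅`;
   and the implicit-function half: at a transverse zero `x` of a `C¹` section of a rank-`p`
   bundle, the zero set `zeroSet s` is, on the frame domain of `x`, the zero set of the real `C¹`
   map `L ∘ u : M → ℝ^{2p}` with onto differential and kernel `ker ∇s(x)`
   (`isNearlyHolomorphicRegularPoint_zeroSet`), whence
   `IsAsymptoticallyHolomorphicSequence.isNearlyHolomorphicCycleSupport_zeroSet`: for all large
   `k`, if `Z(s_k)` is connected it is an `IsNearlyHolomorphicCycleSupport g p (2Cε_k/η) (Z(s_k)) ∅`.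

## Rendering and faithfulness

* ORDERS `0` AND `1` are stated GLOBALLY and INTRINSICALLY (`HasAHFirstOrderBounds`): `h(s, s) ≤ C²`,
  `h(∇_v s, ∇_v s) ≤ C²·(k g(v, v))`, `h(∂̄_v s, ∂̄_v s) ≤ (Cε_k)²·(k g(v, v))` for all `x` and
  `v ∈ T_x M`; the operator norms of the source for `g_k = k g` are these pointwise quadratic
  bounds, squared to avoid square roots. `∇s(x)` is read in the frame of the atlas at `x` (every
  `x` lies in the domain of its own frame, `FiberBundle.mem_baseSet_trivializationAt`); by the
  gauge law of `UnitaryConnection` this is the value of the one global operator `∇_D`.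
* ORDER `2` (`|∇∇s|`, `|∇∂̄s|`) needs a derivative of the `B.Fiber`-valued `1`-form `∇s`, i.e. a
  connection on `T*M` as well. It is stated LOCALLY, in the frame AND the chart of the atlases at a
  point `x₀`, on a neighbourhood `U` of `x₀` with constants depending on `(x₀, U)`
  (`HasAHSecondOrderBoundsOn`; `IsAsymptoticallyHolomorphicSequence` asks
  `∀ x₀, ∃ U ∈ 𝓝 x₀, ∃ C, ∀ᶠ k, …`): the second covariant derivative of the frame-`x₀`
  representative `β = ∇u` is taken as `∇β(ξ, ζ) = ∂_ξ(β(ζ)) + θ_{x₀}(ξ) β(ζ)` in the chart at `x₀`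
  (`covDerivTwoChart`: flat chart derivative of the `1`-form slot plus the connection term on the
  values — the connection term is NOT negligible, `θ_{x₀}` being of size `k` for `L^k`), its values
  measured in `h` (through the frame `s_{x₀}(x)`, `atlasFrame`) and the directions `ξ, ζ` in the
  norm of the model `E`. This differs from the Levi-Civita second covariant derivative of the
  source by the term `β(Γ(ξ, ζ))`, of size `|∇s|_g = O(k^{1/2}) = o(k)` (resp.
  `|∂̄s|_g = O(ε_k k^{1/2}) = o(ε_k k)`) locally uniformly, and the model norm of `E` and `g` are
  locally uniformly equivalent, with constants independent of `k`; so on a compact `M` (finite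
  subcover) the class of asymptotically holomorphic sequences is exactly that of [Auroux1997,
  Def. 1] (with `k^{-1/2}` generalised to `ε_k`), while no Levi-Civita connection is needed. The
  gauge covariance `∇_{x₀}β_{x₀} = a_{x₁x₀} ∇_{x₁}β_{x₁}` of `dβ + θβ` (gauge law (1.16)) makes
  the `h`-norms frame independent.
* Sections are `C^∞` along the frames (clause (i) of the definition; the sources work with smooth
  sections throughout), so that no derivative in the bounds is a junk value.
* `η`-transversality is stated with an explicit real-linear right inverse `R` and the closed bound
  `η²·(k g(Rw, Rw)) ≤ h(w, w)` (the source's strict "`< η⁻¹ k^{-1/2}`" up to the boundary case,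
  immaterial for "transverse to `0`" = `∃ η > 0`); `|s(x)| < η` is `h(s(x), s(x)) < η²`.
* The scale `κ` (intended `κ = k`, `g_k = k g`) and the rate value `e = ε_k` are real parameters
  of the single-index predicates, so that they apply to one bundle at a time.

## What is NOT here

The existence theorems ([Donaldson1996, Thm. 5], [Auroux1997, Thm. 2 and Cor. 1]: asymptotically
holomorphic sections which are uniformly transverse exist for all large `k` on a compact
symplectic manifold) — named facts for a later item; the asymptotic Lefschetz hyperplane
theorem ([Auroux1997, Prop. 2], connectedness of `Z(s_k)` — a hypothesis of
`isNearlyHolomorphicCycleSupport_zeroSet`), symplecticity of `Z` (only the `J`-defect is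
recorded, as the route consumes it); frame-independence statements; the Levi-Civita form of the
second-order bounds. Mathlib (this pin) has no connections on complex vector bundles over a real
base and no `∂̄`-operator on bundle-valued forms (searched: `covariantDeriv`, `dbar`,
`asymptotically`, `transverse` — nothing relevant), whence the frame rendering of the sibling files.

## References

* D. Auroux, *Asymptotically holomorphic families of symplectic submanifolds*, GAFA 7 (1997)
  971–995: Def. 1, Def. 2, Prop. 1, Thm. 2 [Auroux1997].
* S. K. Donaldson, *Symplectic submanifolds and almost-complex geometry*, J. Differential Geom. 44
  (1996) 666–705, §1 [Donaldson1996].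
* D. McDuff, D. Salamon, *Introduction to Symplectic Topology*, 3rd ed. (2017), §7.4: (7.4.1),
  Lemma 7.4.2 [McDuffSalamon2017].
* S. Kobayashi, *Differential Geometry of Complex Vector Bundles* (1987), I.(1.1), (1.16), (4.1);
  III.(1.1) [Kobayashi1987].
-/

noncomputable section

open scoped Manifold ContDiff Topology ComplexConjugate InnerProductSpace
open Bundle Set Module Filter

namespace Literature.Geometry.Kaehler

/-! ### `1`-forms with values in a complex space: value at a point; parts of type `(1,0)`, `(0,1)` -/

section OneForms

variable {E : Type*} [NormedAddCommGroup E] [NormedSpace ℂ E]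
  {M : Type*} [TopologicalSpace M] [ChartedSpace E M]
  {W : Type*} [NormedAddCommGroup W] [NormedSpace ℂ W]

omit [NormedSpace ℂ E] in
/-- `Fin.snoc 0 v = ![v]` as maps `Fin 1 → E` (bridges `continuousMultilinearCurryFin1_apply` and
matrix notation). [folklore] -/
private theorem snoc_zero_eq_vec₁ (v : E) : (Fin.snoc (0 : Fin 0 → E) v : Fin 1 → E) = ![v] := by
  funext i
  fin_cases i
  rfl

/-- The value of a `W`-valued `1`-form at `x` as a continuous real-linear map `v ↦ α_x(v)` on the
tangent space (Mathlib's `continuousMultilinearCurryFin1`). [folklore] -/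
def MForm.app₁ (α : MForm 𝓘(ℝ, E) M W 1) (x : M) : TangentSpace 𝓘(ℝ, E) x →L[ℝ] W :=
  letI a : E [⋀^Fin 1]→L[ℝ] W := α x
  letI f : E →L[ℝ] W := continuousMultilinearCurryFin1 ℝ E W a.toContinuousMultilinearMap
  f

/-- `α.app₁ x v = α_x(v)`. [folklore] -/
@[simp]
theorem MForm.app₁_apply (α : MForm 𝓘(ℝ, E) M W 1) (x : M) (v : TangentSpace 𝓘(ℝ, E) x) :
    α.app₁ x v = α x ![v] := by
  change continuousMultilinearCurryFin1 ℝ E W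
    (show E [⋀^Fin 1]→L[ℝ] W from α x).toContinuousMultilinearMap (show E from v) = _
  rw [continuousMultilinearCurryFin1_apply, ContinuousAlternatingMap.coe_toContinuousMultilinearMap,
    snoc_zero_eq_vec₁]
  rfl

/-- The **`(1,0)`-part of a `1`-form with values in a complex vector space**:
`α^{1,0} = ½(α - i·J^*α)`, i.e. `α^{1,0}(v) = ½(α(v) - iα(Jv))` — the complex-linear part of the
real-linear `α_x` (`α^{1,0}(Jv) = iα^{1,0}(v)`, `MForm.oneZeroPart_apply_tangentJ`). For the
covariant derivative `α = ∇s` of a section this is `∂s = ½(Ds - iDs ∘ J)`; for `α = df` it is the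
tree's `dPrime` (`dPrime_eq_oneZeroPart`). [cite: McDuffSalamon2017, §7.4 (pp. 328–329)] -/
def MForm.oneZeroPart (α : MForm 𝓘(ℝ, E) M W 1) : MForm 𝓘(ℝ, E) M W 1 :=
  (2⁻¹ : ℂ) • (α - Complex.I • α.pullbackJ)

/-- The **`(0,1)`-part of a `1`-form with values in a complex vector space**:
`α^{0,1} = ½(α + i·J^*α)`, i.e. `α^{0,1}(v) = ½(α(v) + iα(Jv))` — the complex-antilinear part
(`α^{0,1}(Jv) = -iα^{0,1}(v)`, `MForm.zeroOnePart_apply_tangentJ`). For `α = ∇s`: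
`∂̄s = ½(Ds + iDs ∘ J)`; for `α = df` the tree's `dDoublePrime` (`dDoublePrime_eq_zeroOnePart`).
[cite: McDuffSalamon2017, §7.4 (pp. 328–329)] -/
def MForm.zeroOnePart (α : MForm 𝓘(ℝ, E) M W 1) : MForm 𝓘(ℝ, E) M W 1 :=
  (2⁻¹ : ℂ) • (α + Complex.I • α.pullbackJ)

/-- `α^{1,0}(v) = ½(α(v) - iα(Jv))` (definitional). [folklore] -/
@[simp]
theorem MForm.oneZeroPart_apply (α : MForm 𝓘(ℝ, E) M W 1) (x : M)
    (v : Fin 1 → TangentSpace 𝓘(ℝ, E) x) :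
    α.oneZeroPart x v = (2⁻¹ : ℂ) • (α x v - Complex.I • α x (fun i ↦ tangentJ E x (v i))) :=
  rfl

/-- `α^{0,1}(v) = ½(α(v) + iα(Jv))` (definitional). [folklore] -/
@[simp]
theorem MForm.zeroOnePart_apply (α : MForm 𝓘(ℝ, E) M W 1) (x : M)
    (v : Fin 1 → TangentSpace 𝓘(ℝ, E) x) :
    α.zeroOnePart x v = (2⁻¹ : ℂ) • (α x v + Complex.I • α x (fun i ↦ tangentJ E x (v i))) :=
  rfl

/-- `α = α^{1,0} + α^{0,1}`. [folklore] -/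
theorem MForm.oneZeroPart_add_zeroOnePart (α : MForm 𝓘(ℝ, E) M W 1) :
    α.oneZeroPart + α.zeroOnePart = α := by
  simp only [MForm.oneZeroPart, MForm.zeroOnePart, ← smul_add, sub_add_add_cancel, ← two_smul ℂ,
    smul_smul]
  norm_num

/-- `0^{1,0} = 0`. [folklore] -/
@[simp]
theorem MForm.oneZeroPart_zero : (0 : MForm 𝓘(ℝ, E) M W 1).oneZeroPart = 0 := by
  simp [MForm.oneZeroPart]

/-- `0^{0,1} = 0`. [folklore] -/
@[simp]
theorem MForm.zeroOnePart_zero : (0 : MForm 𝓘(ℝ, E) M W 1).zeroOnePart = 0 := by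
  simp [MForm.zeroOnePart]

/-- `d′f = (df)^{1,0}` (definitional). [folklore] -/
theorem dPrime_eq_oneZeroPart (f : M → W) :
    dPrime E f = (mextDeriv (MForm.ofFun 𝓘(ℝ, E) f)).oneZeroPart :=
  rfl

/-- `d″f = (df)^{0,1}` (definitional). [folklore] -/
theorem dDoublePrime_eq_zeroOnePart (f : M → W) :
    dDoublePrime E f = (mextDeriv (MForm.ofFun 𝓘(ℝ, E) f)).zeroOnePart :=
  rfl

omit [NormedSpace ℂ W] in
/-- `α_x(-v) = -α_x(v)` for a `1`-form, in matrix notation. [folklore] -/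
theorem MForm.apply_vec_neg {W' : Type*} [NormedAddCommGroup W'] [NormedSpace ℝ W']
    (α : MForm 𝓘(ℝ, E) M W' 1) (x : M) (v : TangentSpace 𝓘(ℝ, E) x) :
    α x ![-v] = -α x ![v] := by
  have h : (![-v] : Fin 1 → TangentSpace 𝓘(ℝ, E) x) = fun i ↦ (-1 : ℝ) • (![v] i) := by
    funext i
    fin_cases i
    simp
  rw [h, ContinuousAlternatingMap.map_smul_univ]
  simp

/-- **The `(1,0)`-part is complex linear**: `α^{1,0}(Jv) = i·α^{1,0}(v)`. [folklore] -/
theorem MForm.oneZeroPart_apply_tangentJ (α : MForm 𝓘(ℝ, E) M W 1) (x : M)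
    (v : TangentSpace 𝓘(ℝ, E) x) :
    α.oneZeroPart x ![tangentJ E x v] = Complex.I • α.oneZeroPart x ![v] := by
  have h1 : (fun i ↦ tangentJ E x ((![tangentJ E x v] : Fin 1 → _) i)) = ![-v] := by
    funext i
    fin_cases i
    simp
  have h2 : (fun i ↦ tangentJ E x ((![v] : Fin 1 → _) i)) = ![tangentJ E x v] := by
    funext i
    fin_cases i
    rfl
  rw [MForm.oneZeroPart_apply, MForm.oneZeroPart_apply, h1, h2, MForm.apply_vec_neg]
  rw [smul_neg, sub_neg_eq_add, smul_comm Complex.I (2⁻¹ : ℂ), smul_sub, smul_smul,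
    Complex.I_mul_I, neg_one_smul, sub_neg_eq_add, add_comm]

/-- **The `(0,1)`-part is complex antilinear**: `α^{0,1}(Jv) = -i·α^{0,1}(v)`. [folklore] -/
theorem MForm.zeroOnePart_apply_tangentJ (α : MForm 𝓘(ℝ, E) M W 1) (x : M)
    (v : TangentSpace 𝓘(ℝ, E) x) :
    α.zeroOnePart x ![tangentJ E x v] = -(Complex.I • α.zeroOnePart x ![v]) := by
  have h1 : (fun i ↦ tangentJ E x ((![tangentJ E x v] : Fin 1 → _) i)) = ![-v] := by
    funext i
    fin_cases i
    simp
  have h2 : (fun i ↦ tangentJ E x ((![v] : Fin 1 → _) i)) = ![tangentJ E x v] := by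
    funext i
    fin_cases i
    rfl
  rw [MForm.zeroOnePart_apply, MForm.zeroOnePart_apply, h1, h2, MForm.apply_vec_neg]
  rw [smul_neg, ← sub_eq_add_neg, smul_comm Complex.I (2⁻¹ : ℂ), smul_add, smul_smul,
    Complex.I_mul_I, neg_one_smul, ← smul_neg, neg_add, neg_neg, neg_add_eq_sub]

/-- `α^{0,1}` vanishes at a point where `α` does. [folklore] -/
theorem MForm.zeroOnePart_eq_zero_of_apply_eq_zero {α : MForm 𝓘(ℝ, E) M W 1} {x : M}
    (h : α x = 0) : α.zeroOnePart x = 0 := by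
  ext v
  rw [MForm.zeroOnePart_apply, h]
  simp

/-- `α^{1,0}` vanishes at a point where `α` does. [folklore] -/
theorem MForm.oneZeroPart_eq_zero_of_apply_eq_zero {α : MForm 𝓘(ℝ, E) M W 1} {x : M}
    (h : α x = 0) : α.oneZeroPart x = 0 := by
  ext v
  rw [MForm.oneZeroPart_apply, h]
  simp

/-- **The second covariant derivative in a chart and a frame.** For an `End F`-valued connection
form `θ` (of a unitary connection in the frame of the atlas at `x₀`) and an `F`-valued `1`-form `β`
(the covariant derivative `∇u` of a section in that frame, or its `(0,1)`-part), the quantity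
`∇β(y)(ξ, ζ) = ∂_ξ(β(ζ))(y) + θ(y)(ξ)(β(y)(ζ))` computed in the chart of `M` at `x₀`
(`MForm.inChart`: `β`, `θ` pulled back along the inverse extended chart; `y` a point of the chart,
`ξ, ζ ∈ E` chart directions; `∂_ξ` the flat derivative `fderiv` of the chart representative).
This is the frame–chart expression of `(∇^{LC} ⊗ 1 + 1 ⊗ ∇_D)(∇s)` WITHOUT the Levi-Civita term
`-β(Γ(ξ, ζ))` (of lower order in the asymptotically holomorphic regime, see the module
docstring); gauge covariant in the frame. Used only to state the second-order bounds
`|∇∇s| = O(k)`, `|∇∂̄s| = O(ε_k k)` of [Auroux1997, Def. 1]. [cite: Auroux1997, Def. 1] -/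
def covDerivTwoChart {F : Type*} [NormedAddCommGroup F] [NormedSpace ℂ F]
    (θ : MForm 𝓘(ℝ, E) M (F →L[ℂ] F) 1) (β : MForm 𝓘(ℝ, E) M F 1) (x₀ : M) (y : E) (ξ ζ : E) : F :=
  fderiv ℝ (β.inChart x₀) y ξ ![ζ] + θ.inChart x₀ y ![ξ] (β.inChart x₀ y ![ζ])

/-- The chart–frame second covariant derivative at `x` of a `1`-form vanishing near `x` is zero
(locality of the chart representative, `MForm.inChart_eventuallyEq`). [folklore] -/
theorem covDerivTwoChart_eq_zero_of_eventuallyEq_zero {F : Type*} [NormedAddCommGroup F]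
    [NormedSpace ℂ F] (θ : MForm 𝓘(ℝ, E) M (F →L[ℂ] F) 1) {β : MForm 𝓘(ℝ, E) M F 1} {x₀ x : M}
    (hx : x ∈ (extChartAt 𝓘(ℝ, E) x₀).source) (hβ : ∀ᶠ w in 𝓝 x, β w = 0) (ξ ζ : E) :
    covDerivTwoChart θ β x₀ (extChartAt 𝓘(ℝ, E) x₀ x) ξ ζ = 0 := by
  have h' : β.inChart x₀ =ᶠ[𝓝 (extChartAt 𝓘(ℝ, E) x₀ x)] (0 : MForm 𝓘(ℝ, E) M F 1).inChart x₀ :=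
    MForm.inChart_eventuallyEq hx (hβ.mono fun w hw ↦ hw)
  rw [MForm.inChart_zero] at h'
  have h0 : fderiv ℝ (β.inChart x₀) (extChartAt 𝓘(ℝ, E) x₀ x) = 0 := by
    rw [h'.fderiv_eq]
    exact fderiv_const_apply 0
  have hval : β.inChart x₀ (extChartAt 𝓘(ℝ, E) x₀ x) = 0 := by
    simpa using h'.self_of_nhds
  rw [covDerivTwoChart, h0, hval]
  simp

end OneForms

/-! ### Sections of a `C^∞` Hermitian bundle in the frames of the atlas; `∇s`, `∂s`, `∂̄s` -/

section Sections

universe u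

variable {E : Type u} [NormedAddCommGroup E] [NormedSpace ℂ E]
  {M : Type u} [TopologicalSpace M] [ChartedSpace E M]

namespace SmoothHermitianBundle

variable (B : SmoothHermitianBundle E M)

/-- **A section read in the frame of the atlas at `x₀`**: the coordinate column
`u_{x₀}(x) = e_{x₀}(s(x)) ∈ F` of `s(x)` in the trivialisation `e_{x₀} = trivializationAt`, so
that `s(x) = s_{x₀}(x)(u_{x₀}(x))` on the frame domain `U_{x₀}` (`atlasFrame`; Kobayashi's
`ξ = Σ ξⁱ sᵢ`, I.(1.1)). Values off `U_{x₀}` are junk. [cite: Kobayashi1987, I.(1.1)] -/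
def inFrame (x₀ : M) (s : ∀ x, B.V x) : M → B.Fiber :=
  fun x ↦ (trivializationAt B.Fiber B.V x₀ (TotalSpace.mk' B.Fiber x (s x))).2

/-- **`Cⁿ` sections** of the `C^∞` Hermitian bundle `B` (`n : WithTop ℕ∞`; `∞` for smooth): the
coordinates of `s` in every frame of the atlas are real-`Cⁿ` on the frame domain (Kobayashi
I.§1: a section is `C^∞` iff its components `ξⁱ` in the local frames are; the transition
functions of `B` being `C^∞`, `SmoothHermitianBundle.contMDiffOn_coordChangeL`, the frames of the
atlas suffice). [cite: Kobayashi1987, I.(1.1)] -/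
def IsContMDiffSection (n : WithTop ℕ∞) (s : ∀ x, B.V x) : Prop :=
  ∀ x₀ : M, ContMDiffOn 𝓘(ℝ, E) 𝓘(ℝ, B.Fiber) n (B.inFrame x₀ s)
    (trivializationAt B.Fiber B.V x₀).baseSet

/-- **The covariant derivative of a section for a unitary connection, in the frame of the atlas at
`x₀`**: the `F`-valued `1`-form `∇u = du + θ_{x₀} u` on `M` (meaningful on `U_{x₀}`), `u` the
coordinates of `s` in the frame and `θ_{x₀} = D.form x₀` the connection form
(`D(s_{x₀} u) = s_{x₀}(du + θ_{x₀} u)`, Kobayashi III.(1.1), I.(1.2); `d` is the tree's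
`mextDeriv ∘ MForm.ofFun`, as in `HermitianHolomorphicBundle.covDeriv`).
[cite: Kobayashi1987, III.(1.1)] -/
def covDeriv (D : UnitaryConnection E B.Fiber B.metric) (x₀ : M) (s : ∀ x, B.V x) :
    MForm 𝓘(ℝ, E) M B.Fiber 1 :=
  mextDeriv (MForm.ofFun 𝓘(ℝ, E) (B.inFrame x₀ s)) + (D.form x₀).endApply (B.inFrame x₀ s)

/-- `(∇u)(v) = du(v) + θ_{x₀}(v) u` (definitional). [cite: Kobayashi1987, III.(1.1)] -/
theorem covDeriv_apply (D : UnitaryConnection E B.Fiber B.metric) (x₀ : M) (s : ∀ x, B.V x)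
    (x : M) (v : Fin 1 → TangentSpace 𝓘(ℝ, E) x) :
    B.covDeriv D x₀ s x v =
      mextDeriv (MForm.ofFun 𝓘(ℝ, E) (B.inFrame x₀ s)) x v + D.form x₀ x v (B.inFrame x₀ s x) :=
  rfl

/-- **`∂_D s` in the frame at `x₀`**: the `(1,0)`-part `½(∇u - i∇u ∘ J)` of the covariant
derivative. [cite: McDuffSalamon2017, §7.4 (pp. 328–329)] -/
def delCovDeriv (D : UnitaryConnection E B.Fiber B.metric) (x₀ : M) (s : ∀ x, B.V x) :
    MForm 𝓘(ℝ, E) M B.Fiber 1 :=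
  (B.covDeriv D x₀ s).oneZeroPart

/-- **`∂̄_D s` in the frame at `x₀`**: the `(0,1)`-part `½(∇u + i∇u ∘ J)` of the covariant
derivative. [cite: McDuffSalamon2017, §7.4 (pp. 328–329)] -/
def delbarCovDeriv (D : UnitaryConnection E B.Fiber B.metric) (x₀ : M) (s : ∀ x, B.V x) :
    MForm 𝓘(ℝ, E) M B.Fiber 1 :=
  (B.covDeriv D x₀ s).zeroOnePart

/-- **`∇s(x) : T_x M →ₗ[ℝ] B.V x`**, the covariant derivative of the section `s` at `x` as a
real-linear map into the fibre: computed in the frame of the atlas at `x` itself (`x ∈ U_x`) and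
mapped back by that frame, `∇s(x)(v) = s_x(x)((du + θ_x u)(x)(v))`. [cite: Auroux1997, Def. 2] -/
def nablaAt (D : UnitaryConnection E B.Fiber B.metric) (s : ∀ x, B.V x) (x : M) :
    TangentSpace 𝓘(ℝ, E) x →ₗ[ℝ] B.V x :=
  ((atlasFrame (F := B.Fiber) B.V x x).restrictScalars ℝ).comp
    ((B.covDeriv D x s).app₁ x : TangentSpace 𝓘(ℝ, E) x →ₗ[ℝ] B.Fiber)

/-- **`∂s(x) : T_x M →ₗ[ℝ] B.V x`**, the `(1,0)`-part of `∇s(x)` (frame at `x`, mapped back to the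
fibre). [cite: McDuffSalamon2017, §7.4 (pp. 328–329)] -/
def delAt (D : UnitaryConnection E B.Fiber B.metric) (s : ∀ x, B.V x) (x : M) :
    TangentSpace 𝓘(ℝ, E) x →ₗ[ℝ] B.V x :=
  ((atlasFrame (F := B.Fiber) B.V x x).restrictScalars ℝ).comp
    ((B.delCovDeriv D x s).app₁ x : TangentSpace 𝓘(ℝ, E) x →ₗ[ℝ] B.Fiber)

/-- **`∂̄s(x) : T_x M →ₗ[ℝ] B.V x`**, the `(0,1)`-part of `∇s(x)` (frame at `x`, mapped back to the
fibre). [cite: McDuffSalamon2017, §7.4 (pp. 328–329)] -/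
def delbarAt (D : UnitaryConnection E B.Fiber B.metric) (s : ∀ x, B.V x) (x : M) :
    TangentSpace 𝓘(ℝ, E) x →ₗ[ℝ] B.V x :=
  ((atlasFrame (F := B.Fiber) B.V x x).restrictScalars ℝ).comp
    ((B.delbarCovDeriv D x s).app₁ x : TangentSpace 𝓘(ℝ, E) x →ₗ[ℝ] B.Fiber)

/-- **The squared `h`-norm `|w|²_h = h(w, w)` of a fibre vector** (real: `HermitianStructure.inner_self_im`).
[cite: Kobayashi1987, I.(4.1)] -/
def hnormSq (x : M) (w : B.V x) : ℝ :=
  (B.metric.inner x w w).re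

/-! #### Unfolding and pointwise linear algebra -/

/-- `∇s(x)(v) = s_x(x)((∇u)(x)(v))`. [folklore] -/
theorem nablaAt_apply (D : UnitaryConnection E B.Fiber B.metric) (s : ∀ x, B.V x) (x : M)
    (v : TangentSpace 𝓘(ℝ, E) x) :
    B.nablaAt D s x v = atlasFrame (F := B.Fiber) B.V x x (B.covDeriv D x s x ![v]) := by
  simp [nablaAt]

/-- `∂s(x)(v) = s_x(x)((∇u)^{1,0}(x)(v))`. [folklore] -/
theorem delAt_apply (D : UnitaryConnection E B.Fiber B.metric) (s : ∀ x, B.V x) (x : M)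
    (v : TangentSpace 𝓘(ℝ, E) x) :
    B.delAt D s x v = atlasFrame (F := B.Fiber) B.V x x (B.delCovDeriv D x s x ![v]) := by
  simp [delAt]

/-- `∂̄s(x)(v) = s_x(x)((∇u)^{0,1}(x)(v))`. [folklore] -/
theorem delbarAt_apply (D : UnitaryConnection E B.Fiber B.metric) (s : ∀ x, B.V x) (x : M)
    (v : TangentSpace 𝓘(ℝ, E) x) :
    B.delbarAt D s x v = atlasFrame (F := B.Fiber) B.V x x (B.delbarCovDeriv D x s x ![v]) := by
  simp [delbarAt]

/-- **`∇s = ∂s + ∂̄s`** pointwise. [cite: McDuffSalamon2017, §7.4 (pp. 328–329)] -/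
theorem delAt_add_delbarAt (D : UnitaryConnection E B.Fiber B.metric) (s : ∀ x, B.V x) (x : M)
    (v : TangentSpace 𝓘(ℝ, E) x) :
    B.delAt D s x v + B.delbarAt D s x v = B.nablaAt D s x v := by
  rw [delAt_apply, delbarAt_apply, nablaAt_apply, ← map_add]
  congr 1
  have h := congrArg (fun β : MForm 𝓘(ℝ, E) M B.Fiber 1 ↦ β x ![v])
    (MForm.oneZeroPart_add_zeroOnePart (B.covDeriv D x s))
  simp only [Pi.add_apply, ContinuousAlternatingMap.add_apply] at h
  exact h

/-- **`∂s` is complex linear**: `∂s(x)(Jv) = i·∂s(x)(v)`. [folklore] -/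
theorem delAt_tangentJ (D : UnitaryConnection E B.Fiber B.metric) (s : ∀ x, B.V x) (x : M)
    (v : TangentSpace 𝓘(ℝ, E) x) :
    B.delAt D s x (tangentJ E x v) = Complex.I • B.delAt D s x v := by
  rw [delAt_apply, delAt_apply, delCovDeriv, MForm.oneZeroPart_apply_tangentJ, map_smul]

/-- **`∂̄s` is complex antilinear**: `∂̄s(x)(Jv) = -i·∂̄s(x)(v)`. [folklore] -/
theorem delbarAt_tangentJ (D : UnitaryConnection E B.Fiber B.metric) (s : ∀ x, B.V x) (x : M)
    (v : TangentSpace 𝓘(ℝ, E) x) :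
    B.delbarAt D s x (tangentJ E x v) = -(Complex.I • B.delbarAt D s x v) := by
  rw [delbarAt_apply, delbarAt_apply, delbarCovDeriv, MForm.zeroOnePart_apply_tangentJ, map_neg,
    map_smul]

/-- **`∇_{Jv}s = i∂_v s - i∂̄_v s`**. [cite: McDuffSalamon2017, Lemma 7.4.2] -/
theorem nablaAt_tangentJ (D : UnitaryConnection E B.Fiber B.metric) (s : ∀ x, B.V x) (x : M)
    (v : TangentSpace 𝓘(ℝ, E) x) :
    B.nablaAt D s x (tangentJ E x v) =
      Complex.I • B.delAt D s x v - Complex.I • B.delbarAt D s x v := by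
  rw [← delAt_add_delbarAt, delAt_tangentJ, delbarAt_tangentJ, sub_eq_add_neg]

/-- **On the kernel of `∇s(x)`, `∇_{Jv}s = -2i ∂̄_v s`** (as `∂_v s = -∂̄_v s` there): the
computation behind "`T Z = ker(∂s + ∂̄s)` is complex iff `∂̄s = 0`, symplectic if `|∂̄s| < |∂s|`".
[cite: McDuffSalamon2017, Lemma 7.4.2] -/
theorem nablaAt_tangentJ_of_eq_zero {D : UnitaryConnection E B.Fiber B.metric} {s : ∀ x, B.V x}
    {x : M} {v : TangentSpace 𝓘(ℝ, E) x} (hv : B.nablaAt D s x v = 0) :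
    B.nablaAt D s x (tangentJ E x v) = (-2 * Complex.I) • B.delbarAt D s x v := by
  have h1 := B.delAt_add_delbarAt D s x v
  rw [hv] at h1
  rw [nablaAt_tangentJ, eq_neg_of_add_eq_zero_left h1]
  module

/-- `|w|²_h ≥ 0`. [folklore] -/
theorem hnormSq_nonneg (x : M) (w : B.V x) : 0 ≤ B.hnormSq x w := by
  by_cases hw : w = 0
  · subst hw
    simp [hnormSq]
  · exact (B.metric.inner_self_pos x w hw).le

/-- `|c·w|²_h = |c|²|w|²_h`. [folklore] -/
theorem hnormSq_smul (x : M) (c : ℂ) (w : B.V x) :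
    B.hnormSq x (c • w) = ‖c‖ ^ 2 * B.hnormSq x w := by
  simp only [hnormSq, LinearMap.map_smulₛₗ₂, LinearMap.map_smul, smul_eq_mul, ← mul_assoc,
    Complex.conj_mul', ← Complex.ofReal_pow, Complex.re_ofReal_mul]

/-! #### The zero section -/

/-- The zero section has zero coordinates on every frame domain. [folklore] -/
theorem inFrame_zero_apply {x₀ x : M} (hx : x ∈ (trivializationAt B.Fiber B.V x₀).baseSet) :
    B.inFrame x₀ 0 x = 0 := by
  have h := congrFun ((trivializationAt B.Fiber B.V x₀).coe_linearMapAt_of_mem (R := ℂ) hx) 0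
  rw [map_zero] at h
  exact h.symm

/-- The covariant derivative of the zero section vanishes on the frame domain (in the frame at
`x₀`). [folklore] -/
theorem covDeriv_zero_apply (D : UnitaryConnection E B.Fiber B.metric) {x₀ x : M}
    (hx : x ∈ (trivializationAt B.Fiber B.V x₀).baseSet) : B.covDeriv D x₀ 0 x = 0 := by
  ext v
  rw [covDeriv_apply, B.inFrame_zero_apply hx, map_zero, add_zero]
  have h : ∀ᶠ w in 𝓝 x, MForm.ofFun 𝓘(ℝ, E) (B.inFrame x₀ 0) w =
      MForm.ofFun 𝓘(ℝ, E) (fun _ : M ↦ (0 : B.Fiber)) w := by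
    filter_upwards [(trivializationAt B.Fiber B.V x₀).open_baseSet.mem_nhds hx] with w hw
    ext u
    simp [MForm.ofFun_apply, B.inFrame_zero_apply hw]
  rw [mextDeriv_congr_of_eventuallyEq h, mextDeriv_ofFun_const]
  rfl

/-- `∂̄` of the zero section vanishes on the frame domain (in the frame at `x₀`). [folklore] -/
theorem delbarCovDeriv_zero_apply (D : UnitaryConnection E B.Fiber B.metric) {x₀ x : M}
    (hx : x ∈ (trivializationAt B.Fiber B.V x₀).baseSet) : B.delbarCovDeriv D x₀ 0 x = 0 :=
  MForm.zeroOnePart_eq_zero_of_apply_eq_zero (B.covDeriv_zero_apply D hx)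

/-- `∇0(x) = 0`. [folklore] -/
theorem nablaAt_zero (D : UnitaryConnection E B.Fiber B.metric) (x : M) : B.nablaAt D 0 x = 0 := by
  ext v
  rw [nablaAt_apply, B.covDeriv_zero_apply D (FiberBundle.mem_baseSet_trivializationAt' x)]
  simp

/-- `∂̄0(x) = 0`. [folklore] -/
theorem delbarAt_zero (D : UnitaryConnection E B.Fiber B.metric) (x : M) :
    B.delbarAt D 0 x = 0 := by
  ext v
  rw [delbarAt_apply, B.delbarCovDeriv_zero_apply D (FiberBundle.mem_baseSet_trivializationAt' x)]
  simp

/-- `|0|²_h = 0`. [folklore] -/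
@[simp]
theorem hnormSq_zero (x : M) : B.hnormSq x 0 = 0 := by
  simp [hnormSq]

/-! ### Asymptotic holomorphicity with a rate; estimated transversality -/

/-- **Asymptotic-holomorphicity bounds of orders `0` and `1`** for ONE section `s` of `B` with
unitary connection `D`, at scale `κ` (the metric `g_κ = κ·g`; `κ = k` for sections of `F ⊗ L^k`),
rate value `e` and constant `C` — the first three bounds of [Auroux1997, Def. 1] written for
`g_κ`, pointwise and squared: `|s(x)|²_h ≤ C²`, `|∇_v s(x)|²_h ≤ C²·κ g(v, v)` (`|∇s|_{g_κ} ≤ C`),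
`|∂̄_v s(x)|²_h ≤ (Ce)²·κ g(v, v)` (`|∂̄s|_{g_κ} ≤ Ce`; the source has `e = κ^{-1/2}`:
"`|s_k| = O(1)`, `|∇s_k| = O(k^{1/2})`, `|∂̄s_k| = O(1)`" in the norms of `g`).
[cite: Auroux1997, Def. 1] -/
def HasAHFirstOrderBounds (D : UnitaryConnection E B.Fiber B.metric)
    (g : RiemannianMetric (fun x : M ↦ TangentSpace 𝓘(ℝ, E) x)) (κ e C : ℝ) (s : ∀ x, B.V x) :
    Prop :=
  (∀ x : M, B.hnormSq x (s x) ≤ C ^ 2) ∧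
  (∀ (x : M) (v : TangentSpace 𝓘(ℝ, E) x),
    B.hnormSq x (B.nablaAt D s x v) ≤ C ^ 2 * (κ * g.inner x v v)) ∧
  (∀ (x : M) (v : TangentSpace 𝓘(ℝ, E) x),
    B.hnormSq x (B.delbarAt D s x v) ≤ (C * e) ^ 2 * (κ * g.inner x v v))

/-- **Asymptotic-holomorphicity bounds of order `2` on `U`, in the frame and chart at `x₀`** for one
section `s` of `B` with unitary connection `D`, at scale `κ`, rate value `e`, constant `C` — the
last two bounds of [Auroux1997, Def. 1], "`|∇∇s_k| = O(k)`, `|∇∂̄s_k| = O(k^{1/2})`" (in the norms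
of `g`; `= O(ε_k k)` for a general rate), rendered locally: for `x ∈ U` and chart directions
`ξ, ζ ∈ E`, the second covariant derivatives `∇(∇u)` and `∇(∂̄u)` of the frame-`x₀`
representative, computed in the chart at `x₀` (`covDerivTwoChart`, at the chart point
`extChartAt x₀ x`) and carried to the fibre over `x` by the frame `s_{x₀}(x)` (`atlasFrame`),
satisfy `|∇∇u(ξ, ζ)|²_h ≤ (Cκ)²‖ξ‖²‖ζ‖²` and `|∇∂̄u(ξ, ζ)|²_h ≤ (Ceκ)²‖ξ‖²‖ζ‖²`; only points of
the frame domain `U_{x₀}` of `B` are constrained (elsewhere the frame representative is junk).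
Intended for `U` a small neighbourhood of `x₀` inside its chart domain, with `C` depending on
`(x₀, U)` (see the module docstring for the equivalence with the intrinsic bounds on compact `M`).
[cite: Auroux1997, Def. 1] -/
def HasAHSecondOrderBoundsOn (D : UnitaryConnection E B.Fiber B.metric) (x₀ : M) (U : Set M)
    (κ e C : ℝ) (s : ∀ x, B.V x) : Prop :=
  ∀ x ∈ U, x ∈ (trivializationAt B.Fiber B.V x₀).baseSet → ∀ ξ ζ : E,
    B.hnormSq x (atlasFrame (F := B.Fiber) B.V x₀ x
        (covDerivTwoChart (D.form x₀) (B.covDeriv D x₀ s) x₀ (extChartAt 𝓘(ℝ, E) x₀ x) ξ ζ)) ≤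
      (C * κ) ^ 2 * (‖ξ‖ ^ 2 * ‖ζ‖ ^ 2) ∧
    B.hnormSq x (atlasFrame (F := B.Fiber) B.V x₀ x
        (covDerivTwoChart (D.form x₀) (B.delbarCovDeriv D x₀ s) x₀ (extChartAt 𝓘(ℝ, E) x₀ x)
          ξ ζ)) ≤
      (C * (e * κ)) ^ 2 * (‖ξ‖ ^ 2 * ‖ζ‖ ^ 2)

/-- **An asymptotically holomorphic sequence of sections with rate `ε`** (Donaldson; Auroux's
Definition 1, with the printed rate `k^{-1/2}` replaced by a free rate `ε_k`). Data: `C^∞`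
Hermitian bundles `B k` over `M` (intended: the twists `F ⊗ L^k`, `SmoothHermitianBundle.tensorLinePow
F L k`), unitary connections `D k` on them, a Riemannian metric `g` on `M` (rescaled to
`g_k = k·g`), the rate `ε`, sections `s k` of `B k`. Conditions: (i) every `s k` is a `C^∞`
section (`IsContMDiffSection`); (ii) for some `C` and all large `k`, `|s_k| ≤ C`,
`|∇s_k|_{g_k} ≤ C`, `|∂̄s_k|_{g_k} ≤ Cε_k` everywhere (`HasAHFirstOrderBounds`, intrinsic);
(iii) every `x₀` has a neighbourhood `U` and a constant `C` with, for all large `k`,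
`|∇∇s_k|_{g_k} ≤ C` and `|∇∂̄s_k|_{g_k} ≤ Cε_k` on `U` in the frame and chart at `x₀`
(`HasAHSecondOrderBoundsOn`). Source, for `E ⊗ L^k` over a compact almost-Kähler `(X, ω, J, g)`
and `ε_k = k^{-1/2}`: "A sequence of sections `s_k` of `E ⊗ L^k` (for large `k`) is said to be
asymptotically holomorphic with respect to the given connections and almost-complex structure if
the following bounds hold: `|s_k| = O(1)`, `|∇s_k| = O(k^{1/2})`, `|∂̄s_k| = O(1)`,
`|∇∇s_k| = O(k)`, `|∇∂̄s_k| = O(k^{1/2})`." (Introduced for line bundles in [Donaldson1996, §1].)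
[cite: Auroux1997, Def. 1] -/
def IsAsymptoticallyHolomorphicSequence (B : ℕ → SmoothHermitianBundle E M)
    (D : ∀ k, UnitaryConnection E (B k).Fiber (B k).metric)
    (g : RiemannianMetric (fun x : M ↦ TangentSpace 𝓘(ℝ, E) x)) (ε : ℕ → ℝ)
    (s : ∀ k x, (B k).V x) : Prop :=
  (∀ k, (B k).IsContMDiffSection ∞ (s k)) ∧
  (∃ C : ℝ, ∀ᶠ k : ℕ in atTop, (B k).HasAHFirstOrderBounds (D k) g k (ε k) C (s k)) ∧
  (∀ x₀ : M, ∃ U ∈ 𝓝 x₀, ∃ C : ℝ, ∀ᶠ k : ℕ in atTop,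
    (B k).HasAHSecondOrderBoundsOn (D k) x₀ U k (ε k) C (s k))

/-- **`s` is `η`-transverse to `0`** at scale `κ` (metric `g_κ = κ·g`; `κ = k` for `F ⊗ L^k`),
Auroux's Definition 2: wherever `|s(x)|_h < η`, the covariant derivative
`∇s(x) : T_x M → B.V x` is surjective and admits a (real-linear) right inverse `R` of
`g_κ → h` operator norm at most `η⁻¹`, i.e. `η²·κ g(Rw, Rw) ≤ |w|²_h` for all `w`. Source: "A
section `s` of a vector bundle `E ⊗ L^k` is said to be `η`-transverse to `0` if whenever
`|s(x)| < η`, the covariant derivative `∇s(x) : T_x X → (E ⊗ L^k)_x` is surjective and admits a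
right inverse whose norm is smaller than `η⁻¹ k^{-1/2}`" (norms of `g`; we use the closed bound).
"In the case of line bundles, `η`-transversality to `0` simply means that the covariant
derivative of the section is larger than `ηk^{1/2}` wherever the section is smaller than `η`"
(ibid.; the notion of [Donaldson1996, §1]). [cite: Auroux1997, Def. 2] -/
def IsEtaTransverse (D : UnitaryConnection E B.Fiber B.metric)
    (g : RiemannianMetric (fun x : M ↦ TangentSpace 𝓘(ℝ, E) x)) (κ η : ℝ) (s : ∀ x, B.V x) :
    Prop :=
  ∀ x : M, B.hnormSq x (s x) < η ^ 2 →
    ∃ R : B.V x →ₗ[ℝ] TangentSpace 𝓘(ℝ, E) x,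
      (∀ w, B.nablaAt D s x (R w) = w) ∧ ∀ w, η ^ 2 * (κ * g.inner x (R w) (R w)) ≤ B.hnormSq x w

/-- **A uniformly transverse (transverse to `0`) sequence of sections**: "A family of sections is
transverse to `0` if there exists an `η > 0` such that `η`-transversality to `0` holds for all
large values of `k`" (scale `κ = k`). [cite: Auroux1997, Def. 2] -/
def IsUniformlyTransverseSequence (B : ℕ → SmoothHermitianBundle E M)
    (D : ∀ k, UnitaryConnection E (B k).Fiber (B k).metric)
    (g : RiemannianMetric (fun x : M ↦ TangentSpace 𝓘(ℝ, E) x)) (s : ∀ k x, (B k).V x) : Prop :=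
  ∃ η : ℝ, 0 < η ∧ ∀ᶠ k : ℕ in atTop, (B k).IsEtaTransverse (D k) g k η (s k)

/-! #### Unfolding, projections, monotonicity -/

/-- Unfolding of `IsAsymptoticallyHolomorphicSequence`. [folklore] -/
theorem isAsymptoticallyHolomorphicSequence_iff {B : ℕ → SmoothHermitianBundle E M}
    {D : ∀ k, UnitaryConnection E (B k).Fiber (B k).metric}
    {g : RiemannianMetric (fun x : M ↦ TangentSpace 𝓘(ℝ, E) x)} {ε : ℕ → ℝ}
    {s : ∀ k x, (B k).V x} :
    IsAsymptoticallyHolomorphicSequence B D g ε s ↔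
      (∀ k, (B k).IsContMDiffSection ∞ (s k)) ∧
      (∃ C : ℝ, ∀ᶠ k : ℕ in atTop, (B k).HasAHFirstOrderBounds (D k) g k (ε k) C (s k)) ∧
      (∀ x₀ : M, ∃ U ∈ 𝓝 x₀, ∃ C : ℝ, ∀ᶠ k : ℕ in atTop,
        (B k).HasAHSecondOrderBoundsOn (D k) x₀ U k (ε k) C (s k)) :=
  Iff.rfl

/-- Unfolding of `HasAHFirstOrderBounds`. [folklore] -/
theorem hasAHFirstOrderBounds_iff {D : UnitaryConnection E B.Fiber B.metric}
    {g : RiemannianMetric (fun x : M ↦ TangentSpace 𝓘(ℝ, E) x)} {κ e C : ℝ} {s : ∀ x, B.V x} :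
    B.HasAHFirstOrderBounds D g κ e C s ↔
      (∀ x : M, B.hnormSq x (s x) ≤ C ^ 2) ∧
      (∀ (x : M) (v : TangentSpace 𝓘(ℝ, E) x),
        B.hnormSq x (B.nablaAt D s x v) ≤ C ^ 2 * (κ * g.inner x v v)) ∧
      (∀ (x : M) (v : TangentSpace 𝓘(ℝ, E) x),
        B.hnormSq x (B.delbarAt D s x v) ≤ (C * e) ^ 2 * (κ * g.inner x v v)) :=
  Iff.rfl

/-- Unfolding of `IsEtaTransverse`. [folklore] -/
theorem isEtaTransverse_iff {D : UnitaryConnection E B.Fiber B.metric}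
    {g : RiemannianMetric (fun x : M ↦ TangentSpace 𝓘(ℝ, E) x)} {κ η : ℝ} {s : ∀ x, B.V x} :
    B.IsEtaTransverse D g κ η s ↔
      ∀ x : M, B.hnormSq x (s x) < η ^ 2 →
        ∃ R : B.V x →ₗ[ℝ] TangentSpace 𝓘(ℝ, E) x,
          (∀ w, B.nablaAt D s x (R w) = w) ∧
            ∀ w, η ^ 2 * (κ * g.inner x (R w) (R w)) ≤ B.hnormSq x w :=
  Iff.rfl

/-- An asymptotically holomorphic sequence consists of `C^∞` sections. [folklore] -/
theorem IsAsymptoticallyHolomorphicSequence.isContMDiffSection {B : ℕ → SmoothHermitianBundle E M}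
    {D : ∀ k, UnitaryConnection E (B k).Fiber (B k).metric}
    {g : RiemannianMetric (fun x : M ↦ TangentSpace 𝓘(ℝ, E) x)} {ε : ℕ → ℝ}
    {s : ∀ k x, (B k).V x} (h : IsAsymptoticallyHolomorphicSequence B D g ε s) (k : ℕ) :
    (B k).IsContMDiffSection ∞ (s k) :=
  h.1 k

/-- The first-order bounds of an asymptotically holomorphic sequence. [folklore] -/
theorem IsAsymptoticallyHolomorphicSequence.exists_hasAHFirstOrderBounds
    {B : ℕ → SmoothHermitianBundle E M} {D : ∀ k, UnitaryConnection E (B k).Fiber (B k).metric}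
    {g : RiemannianMetric (fun x : M ↦ TangentSpace 𝓘(ℝ, E) x)} {ε : ℕ → ℝ}
    {s : ∀ k x, (B k).V x} (h : IsAsymptoticallyHolomorphicSequence B D g ε s) :
    ∃ C : ℝ, ∀ᶠ k : ℕ in atTop, (B k).HasAHFirstOrderBounds (D k) g k (ε k) C (s k) :=
  h.2.1

/-- The second-order (local) bounds of an asymptotically holomorphic sequence. [folklore] -/
theorem IsAsymptoticallyHolomorphicSequence.exists_hasAHSecondOrderBoundsOn
    {B : ℕ → SmoothHermitianBundle E M} {D : ∀ k, UnitaryConnection E (B k).Fiber (B k).metric}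
    {g : RiemannianMetric (fun x : M ↦ TangentSpace 𝓘(ℝ, E) x)} {ε : ℕ → ℝ}
    {s : ∀ k x, (B k).V x} (h : IsAsymptoticallyHolomorphicSequence B D g ε s) (x₀ : M) :
    ∃ U ∈ 𝓝 x₀, ∃ C : ℝ, ∀ᶠ k : ℕ in atTop,
      (B k).HasAHSecondOrderBoundsOn (D k) x₀ U k (ε k) C (s k) :=
  h.2.2 x₀

/-- Where `|s(x)| < η`, the covariant derivative of an `η`-transverse section is onto the fibre.
[cite: Auroux1997, Def. 2] -/
theorem IsEtaTransverse.surjective_nablaAt {D : UnitaryConnection E B.Fiber B.metric}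
    {g : RiemannianMetric (fun x : M ↦ TangentSpace 𝓘(ℝ, E) x)} {κ η : ℝ} {s : ∀ x, B.V x}
    (h : B.IsEtaTransverse D g κ η s) {x : M} (hx : B.hnormSq x (s x) < η ^ 2) :
    Function.Surjective (B.nablaAt D s x) := by
  obtain ⟨R, hR, -⟩ := h x hx
  exact fun w ↦ ⟨R w, hR w⟩

/-- `η`-transversality weakens with `η`: `η`-transverse implies `η'`-transverse for
`0 ≤ η' ≤ η` (at a nonnegative scale). [cite: Auroux1997, Def. 2] -/
theorem IsEtaTransverse.mono {D : UnitaryConnection E B.Fiber B.metric}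
    {g : RiemannianMetric (fun x : M ↦ TangentSpace 𝓘(ℝ, E) x)} {κ η η' : ℝ} {s : ∀ x, B.V x}
    (h : B.IsEtaTransverse D g κ η s) (hκ : 0 ≤ κ) (hη' : 0 ≤ η') (hle : η' ≤ η) :
    B.IsEtaTransverse D g κ η' s := by
  intro x hx
  obtain ⟨R, hR, hRle⟩ := h x (hx.trans_le (pow_le_pow_left₀ hη' hle 2))
  refine ⟨R, hR, fun w ↦ (mul_le_mul_of_nonneg_right (pow_le_pow_left₀ hη' hle 2) ?_).trans
    (hRle w)⟩
  exact mul_nonneg hκ (riemannianMetric_inner_self_nonneg g x (R w))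

/-! ### The angle estimate: `J`-defect of `ker ∇s(x)` -/

/-- **Donaldson's angle estimate (linear algebra).** If `∇s(x)` has a right inverse `R` with
`η²·κ g(Rw, Rw) ≤ |w|²_h` (`g_κ → h` norm `≤ η⁻¹`, `η, κ > 0`) and `|∂̄_v s(x)|²_h ≤ b²·κ g(v, v)`
(`|∂̄s(x)|_{g_κ} ≤ b`), then the kernel `V = ker ∇s(x)` (the tangent space of the zero set at a
transverse zero) is nearly complex with defect `≤ 2b/η` for `g`: for `v ∈ V`,
`∇_{Jv}s = -2i∂̄_v s` (`nablaAt_tangentJ_of_eq_zero`), so `w = Jv - R(∇_{Jv} s) ∈ V` and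
`|Jv - w|_g = |R(∇_{Jv}s)|_g ≤ η⁻¹κ^{-1/2}·2|∂̄_v s|_h ≤ (2b/η)|v|_g`. With `b = Cε_k`: the zero
sets of asymptotically holomorphic, `η`-transverse sections are "asymptotically `J`-holomorphic,
i.e. `J(TW_k)` is within `O(k^{-1/2})` [here `O(ε_k)`] of `TW_k`". [cite: Auroux1997, Prop. 1] -/
theorem hasJDefectLE_ker_nablaAt (g : RiemannianMetric (fun x : M ↦ TangentSpace 𝓘(ℝ, E) x))
    {D : UnitaryConnection E B.Fiber B.metric} {s : ∀ x, B.V x} {x : M} {κ η b : ℝ}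
    (hκ : 0 < κ) (hη : 0 < η) (R : B.V x →ₗ[ℝ] TangentSpace 𝓘(ℝ, E) x)
    (hR : ∀ w, B.nablaAt D s x (R w) = w)
    (hRle : ∀ w, η ^ 2 * (κ * g.inner x (R w) (R w)) ≤ B.hnormSq x w)
    (hbar : ∀ v, B.hnormSq x (B.delbarAt D s x v) ≤ b ^ 2 * (κ * g.inner x v v)) :
    HasJDefectLE g x (2 * b / η) {v | B.nablaAt D s x v = 0} := by
  intro v hv
  simp only [Set.mem_setOf_eq] at hv ⊢
  set y := B.nablaAt D s x (tangentJ E x v) with hy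
  refine ⟨tangentJ E x v - R y, ?_, ?_⟩
  · rw [map_sub, hR, sub_self]
  · rw [sub_sub_cancel]
    have h2 : B.hnormSq x y = 4 * B.hnormSq x (B.delbarAt D s x v) := by
      rw [hy, B.nablaAt_tangentJ_of_eq_zero hv, hnormSq_smul]
      norm_num
    have key : η ^ 2 * g.inner x (R y) (R y) ≤ 4 * b ^ 2 * g.inner x v v := by
      have h4 : κ * (η ^ 2 * g.inner x (R y) (R y)) ≤ κ * (4 * b ^ 2 * g.inner x v v) :=
        calc κ * (η ^ 2 * g.inner x (R y) (R y)) = η ^ 2 * (κ * g.inner x (R y) (R y)) := by ring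
          _ ≤ B.hnormSq x y := hRle y
          _ = 4 * B.hnormSq x (B.delbarAt D s x v) := h2
          _ ≤ 4 * (b ^ 2 * (κ * g.inner x v v)) := by gcongr; exact hbar v
          _ = κ * (4 * b ^ 2 * g.inner x v v) := by ring
      exact le_of_mul_le_mul_left h4 hκ
    calc g.inner x (R y) (R y) = (η ^ 2 * g.inner x (R y) (R y)) / η ^ 2 := by
          field_simp
      _ ≤ (4 * b ^ 2 * g.inner x v v) / η ^ 2 := by gcongr
      _ = (2 * b / η) ^ 2 * g.inner x v v := by
          field_simp
          ring

/-- **The tangent spaces of the zero sets of an asymptotically holomorphic, uniformly transverse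
sequence are nearly complex with defect `O(ε_k)`**: if `s` is asymptotically holomorphic with rate
`ε` and `η`-transverse for all large `k` (`η > 0`), there is `C` such that for all large `k`, at
every point `x` with `|s_k(x)| < η` (in particular on the zero set of `s_k`), `ker ∇s_k(x)` has
`J`-defect `≤ 2Cε_k/η` for `g` — the pointwise content of "`J(TW_k)` is within `O(k^{-1/2})` of
`TW_k`" and the defect clause of `IsNearlyHolomorphicRegularPoint g p (2Cε_k/η) (Z(s_k)) x`.
[cite: Auroux1997, Prop. 1] -/
theorem IsAsymptoticallyHolomorphicSequence.hasJDefectLE_ker {B : ℕ → SmoothHermitianBundle E M}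
    {D : ∀ k, UnitaryConnection E (B k).Fiber (B k).metric}
    {g : RiemannianMetric (fun x : M ↦ TangentSpace 𝓘(ℝ, E) x)} {ε : ℕ → ℝ}
    {s : ∀ k x, (B k).V x} {η : ℝ} (hAH : IsAsymptoticallyHolomorphicSequence B D g ε s)
    (hη : 0 < η) (hT : ∀ᶠ k : ℕ in atTop, (B k).IsEtaTransverse (D k) g k η (s k)) :
    ∃ C : ℝ, ∀ᶠ k : ℕ in atTop, ∀ x : M, (B k).hnormSq x (s k x) < η ^ 2 →
      HasJDefectLE g x (2 * (C * ε k) / η) {v | (B k).nablaAt (D k) (s k) x v = 0} := by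
  obtain ⟨C, hC⟩ := hAH.exists_hasAHFirstOrderBounds
  refine ⟨C, ?_⟩
  filter_upwards [hC, hT, eventually_gt_atTop 0] with k hk hTk hk0 x hx
  obtain ⟨R, hR, hRle⟩ := hTk x hx
  exact (B k).hasJDefectLE_ker_nablaAt g (by exact_mod_cast hk0) hη R hR hRle (hk.2.2 x)

/-! ### Non-vacuity: the zero sections -/

/-- **Non-vacuity / consistency check.** For ANY sequence of `C^∞` Hermitian bundles with unitary
connections, any metric and any rate, the zero sections form an asymptotically holomorphic
sequence (all the quantities bounded vanish: `∇0 = 0` on every frame domain, whence the first-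
and second-order expressions are `0`; the second-order clause is witnessed by the chart domain of
`x₀` and `C = 0`). The zero sequence is of course never transverse to `0` (unless the fibres are
trivial); it shows that the definition constrains no junk value. [folklore] -/
theorem isAsymptoticallyHolomorphicSequence_zero (B : ℕ → SmoothHermitianBundle E M)
    (D : ∀ k, UnitaryConnection E (B k).Fiber (B k).metric)
    (g : RiemannianMetric (fun x : M ↦ TangentSpace 𝓘(ℝ, E) x)) (ε : ℕ → ℝ) :
    IsAsymptoticallyHolomorphicSequence B D g ε (fun _ ↦ 0) := by
  refine ⟨fun k x₀ ↦ ?_, ⟨0, Eventually.of_forall fun _ ↦ ⟨fun x ↦ ?_, fun x v ↦ ?_, fun x v ↦ ?_⟩⟩,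
    fun x₀ ↦ ⟨(extChartAt 𝓘(ℝ, E) x₀).source, extChartAt_source_mem_nhds x₀, 0,
      Eventually.of_forall fun k x hx hxU ξ ζ ↦ ?_⟩⟩
  · exact contMDiffOn_const.congr fun x hx ↦ (B k).inFrame_zero_apply hx
  · simp
  · rw [nablaAt_zero]
    simp
  · rw [delbarAt_zero]
    simp
  · have hβ : ∀ᶠ w in 𝓝 x, (B k).covDeriv (D k) x₀ 0 w = 0 := by
      filter_upwards [(trivializationAt (B k).Fiber (B k).V x₀).open_baseSet.mem_nhds hxU]
        with w hw using (B k).covDeriv_zero_apply (D k) hw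
    have hβ' : ∀ᶠ w in 𝓝 x, (B k).delbarCovDeriv (D k) x₀ 0 w = 0 :=
      hβ.mono fun w hw ↦ MForm.zeroOnePart_eq_zero_of_apply_eq_zero hw
    rw [covDerivTwoChart_eq_zero_of_eventuallyEq_zero _ hx hβ,
      covDerivTwoChart_eq_zero_of_eventuallyEq_zero _ hx hβ']
    simp

/-! ### Zero sets: transverse zeros are nearly holomorphic regular points -/

/-- **The zero set `Z(s) = {x | s(x) = 0}` of a section.** [cite: Auroux1997, Prop. 1] -/
def zeroSet (s : ∀ x, B.V x) : Set M :=
  {x | s x = 0}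

/-- Membership in the zero set (definitional). [folklore] -/
@[simp]
theorem mem_zeroSet_iff (s : ∀ x, B.V x) (x : M) : x ∈ B.zeroSet s ↔ s x = 0 :=
  Iff.rfl

/-- On the frame domain `U_{x₀}`, the coordinates of `s` in the frame are those of `s(x)` under
the linear isomorphism `e_{x₀}(x) : B.V x ≃ F`. [cite: Kobayashi1987, I.(1.1)] -/
theorem inFrame_apply_of_mem (x₀ : M) (s : ∀ x, B.V x) {x : M}
    (hx : x ∈ (trivializationAt B.Fiber B.V x₀).baseSet) :
    B.inFrame x₀ s x = (trivializationAt B.Fiber B.V x₀).linearEquivAt ℂ x hx (s x) :=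
  rfl

/-- On the frame domain, `u_{x₀}(x) = 0 ↔ s(x) = 0`. [folklore] -/
theorem inFrame_eq_zero_iff (x₀ : M) (s : ∀ x, B.V x) {x : M}
    (hx : x ∈ (trivializationAt B.Fiber B.V x₀).baseSet) :
    B.inFrame x₀ s x = 0 ↔ s x = 0 := by
  rw [B.inFrame_apply_of_mem x₀ s hx, LinearEquiv.map_eq_zero_iff]

/-- On the frame domain the frame `s_{x₀}(x) : F → B.V x` is injective. [folklore] -/
theorem atlasFrame_injective {x₀ x : M} (hx : x ∈ (trivializationAt B.Fiber B.V x₀).baseSet) :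
    Function.Injective (atlasFrame (F := B.Fiber) B.V x₀ x) := by
  intro v w hvw
  have h : ((trivializationAt B.Fiber B.V x₀).linearEquivAt ℂ x hx).symm v =
      ((trivializationAt B.Fiber B.V x₀).linearEquivAt ℂ x hx).symm w := by
    simpa [atlasFrame, Trivialization.coe_symmₗ _ hx] using hvw
  exact (LinearEquiv.injective _) h

/-- **The zero set of a continuous section is closed.** [folklore] -/
theorem isClosed_zeroSet {n : WithTop ℕ∞} {s : ∀ x, B.V x} (hs : B.IsContMDiffSection n s) :
    IsClosed (B.zeroSet s) := by
  rw [← isOpen_compl_iff, isOpen_iff_forall_mem_open]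
  intro x hx
  simp only [mem_compl_iff, mem_zeroSet_iff] at hx
  set e := trivializationAt B.Fiber B.V x with he
  have hxU : x ∈ e.baseSet := FiberBundle.mem_baseSet_trivializationAt' x
  have hcont : ContinuousOn (B.inFrame x s) e.baseSet := (hs x).continuousOn
  refine ⟨e.baseSet ∩ B.inFrame x s ⁻¹' {w | w ≠ 0}, fun y hy ↦ ?_,
    hcont.isOpen_inter_preimage e.open_baseSet isOpen_ne, ⟨hxU, ?_⟩⟩
  · simp only [mem_compl_iff, mem_zeroSet_iff]
    exact fun h0 ↦ hy.2 ((B.inFrame_eq_zero_iff x s hy.1).2 h0)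
  · exact fun h0 ↦ hx ((B.inFrame_eq_zero_iff x s hxU).1 h0)

variable [IsManifold 𝓘(ℝ, E) ∞ M]

/-- At a ZERO `x` of a `C¹` section, the covariant derivative in the frame at `x` is the plain
differential of the coordinates: `(∇u)(x)(v) = du(x)(v) = mfderiv u x v` (the connection term
`θ(v)u(x)` vanishes with `u(x)`) — "at the point where the section vanishes, `∂s` and `∂̄s` are
independent of the choice of the connection". [cite: McDuffSalamon2017, Lemma 7.4.2 (proof)] -/
theorem covDeriv_apply_of_eq_zero (D : UnitaryConnection E B.Fiber B.metric) {s : ∀ x, B.V x}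
    {x : M} (hs : B.IsContMDiffSection 1 s) (hx : s x = 0) (v : TangentSpace 𝓘(ℝ, E) x) :
    B.covDeriv D x s x ![v] = mfderiv 𝓘(ℝ, E) 𝓘(ℝ, B.Fiber) (B.inFrame x s) x v := by
  have hxU : x ∈ (trivializationAt B.Fiber B.V x).baseSet :=
    FiberBundle.mem_baseSet_trivializationAt' x
  have hux : B.inFrame x s x = 0 := (B.inFrame_eq_zero_iff x s hxU).2 hx
  have hdiff : MDifferentiableAt 𝓘(ℝ, E) 𝓘(ℝ, B.Fiber) (B.inFrame x s) x :=
    ((hs x).contMDiffAt ((trivializationAt B.Fiber B.V x).open_baseSet.mem_nhds hxU))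
      |>.mdifferentiableAt one_ne_zero
  rw [covDeriv_apply, hux, map_zero, add_zero, mextDeriv_ofFun_apply, hdiff.mfderiv]
  simp only [writtenInExtChartAt, extChartAt_model_space_eq_id, PartialEquiv.refl_coe,
    Function.id_comp, Matrix.cons_val_zero]
  rfl

/-- **Transverse zeros are nearly holomorphic regular points (implicit function theorem and the
angle estimate).** Let `s` be a `C¹` section of the `C^∞` Hermitian bundle `B` of rank `p` over the
complex manifold `M`, `D` a unitary connection, `x` a zero of `s` at which `∇s(x)` has a right
inverse `R` with `η²·κ g(Rw, Rw) ≤ |w|²_h` (`η, κ > 0`) and `|∂̄_v s(x)|²_h ≤ b²·κ g(v, v)`. Then `x`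
is a nearly holomorphic regular point of the zero set `Z(s)` of codimension `p` and defect
`≤ 2b/η`: on the frame domain `U_x`, `Z(s) ∩ U_x` is the zero set of the real `C¹` map
`L ∘ u : M → ℝ^{2p}` (`u` the coordinates of `s` in the frame at `x`, `L : F ≃ ℝ^{2p}` real
linear), whose differential at `x` is `L ∘ ∇s(x)` read in the frame — onto, with kernel
`ker ∇s(x)` of `J`-defect `≤ 2b/η` (`hasJDefectLE_ker_nablaAt`). This is the pointwise half of
[Auroux1997, Prop. 1] / [McDuffSalamon2017, Lemma 7.4.2] in the currency of
`IsNearlyHolomorphicRegularPoint`. [cite: Auroux1997, Prop. 1] -/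
theorem isNearlyHolomorphicRegularPoint_zeroSet
    (g : RiemannianMetric (fun x : M ↦ TangentSpace 𝓘(ℝ, E) x))
    {D : UnitaryConnection E B.Fiber B.metric} {s : ∀ x, B.V x} {x : M} {p : ℕ} {κ η b : ℝ}
    (hp : B.rank = p) (hs : B.IsContMDiffSection 1 s) (hx : s x = 0) (hκ : 0 < κ) (hη : 0 < η)
    (R : B.V x →ₗ[ℝ] TangentSpace 𝓘(ℝ, E) x) (hR : ∀ w, B.nablaAt D s x (R w) = w)
    (hRle : ∀ w, η ^ 2 * (κ * g.inner x (R w) (R w)) ≤ B.hnormSq x w)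
    (hbar : ∀ v, B.hnormSq x (B.delbarAt D s x v) ≤ b ^ 2 * (κ * g.inner x v v)) :
    IsNearlyHolomorphicRegularPoint g p (2 * b / η) (B.zeroSet s) x := by
  have hxU : x ∈ (trivializationAt B.Fiber B.V x).baseSet :=
    FiberBundle.mem_baseSet_trivializationAt' x
  -- a real-linear identification `F ≃ ℝ^{2p}`
  have hrank : Module.finrank ℝ B.Fiber = Module.finrank ℝ (Fin (2 * p) → ℝ) := by
    rw [finrank_real_of_complex, Module.finrank_fin_fun, ← hp]
    rfl
  let L : B.Fiber ≃L[ℝ] (Fin (2 * p) → ℝ) := ContinuousLinearEquiv.ofFinrankEq hrank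
  have hdiff : MDifferentiableAt 𝓘(ℝ, E) 𝓘(ℝ, B.Fiber) (B.inFrame x s) x :=
    ((hs x).contMDiffAt ((trivializationAt B.Fiber B.V x).open_baseSet.mem_nhds hxU))
      |>.mdifferentiableAt one_ne_zero
  have hL : HasMFDerivAt 𝓘(ℝ, B.Fiber) 𝓘(ℝ, Fin (2 * p) → ℝ) (L : B.Fiber → (Fin (2 * p) → ℝ))
      (B.inFrame x s x) (L : B.Fiber →L[ℝ] (Fin (2 * p) → ℝ)) :=
    (L : B.Fiber →L[ℝ] (Fin (2 * p) → ℝ)).hasMFDerivAt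
  have happly : ∀ v : E,
      mfderiv 𝓘(ℝ, E) 𝓘(ℝ, Fin (2 * p) → ℝ) ((L : B.Fiber → (Fin (2 * p) → ℝ)) ∘ B.inFrame x s)
          x v = L (mfderiv 𝓘(ℝ, E) 𝓘(ℝ, B.Fiber) (B.inFrame x s) x v) := fun v ↦ by
    rw [(hL.comp x hdiff.hasMFDerivAt).mfderiv]
    rfl
  -- `∇s(x)(v) = s_x(x)(du(x)(v))` at the zero `x`
  have hnabla : ∀ v : E, B.nablaAt D s x v =
      atlasFrame (F := B.Fiber) B.V x x (mfderiv 𝓘(ℝ, E) 𝓘(ℝ, B.Fiber) (B.inFrame x s) x v) :=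
    fun v ↦ by rw [nablaAt_apply, B.covDeriv_apply_of_eq_zero D hs hx v]
  have hker : ∀ v : E,
      mfderiv 𝓘(ℝ, E) 𝓘(ℝ, Fin (2 * p) → ℝ) ((L : B.Fiber → (Fin (2 * p) → ℝ)) ∘ B.inFrame x s)
          x v = 0 ↔ B.nablaAt D s x v = 0 := fun v ↦ by
    rw [happly, hnabla]
    change L _ = (0 : Fin (2 * p) → ℝ) ↔ _
    rw [L.map_eq_zero_iff, ← (B.atlasFrame_injective hxU).eq_iff, map_zero]
  refine ⟨(trivializationAt B.Fiber B.V x).baseSet, (trivializationAt B.Fiber B.V x).open_baseSet,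
    hxU, (L : B.Fiber → (Fin (2 * p) → ℝ)) ∘ B.inFrame x s, ?_, ?_, ?_, ?_⟩
  · -- real `C¹`
    exact (L : B.Fiber →L[ℝ] (Fin (2 * p) → ℝ)).contMDiff.comp_contMDiffOn (hs x)
  · -- same zero set on the frame domain
    ext y
    simp only [mem_inter_iff, mem_zeroSet_iff, mem_preimage, Function.comp_apply,
      mem_singleton_iff]
    constructor
    · rintro ⟨hy0, hyU⟩
      exact ⟨hyU, by rw [(B.inFrame_eq_zero_iff x s hyU).2 hy0, map_zero]⟩
    · rintro ⟨hyU, hy0⟩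
      exact ⟨(B.inFrame_eq_zero_iff x s hyU).1 (L.map_eq_zero_iff.1 hy0), hyU⟩
  · -- surjective differential
    intro y
    refine ⟨R (atlasFrame (F := B.Fiber) B.V x x (L.symm y)), ?_⟩
    have h1 := hR (atlasFrame (F := B.Fiber) B.V x x (L.symm y))
    rw [hnabla] at h1
    rw [happly, B.atlasFrame_injective hxU h1, ContinuousLinearEquiv.apply_symm_apply]
  · -- the angle estimate on `ker ∇s(x)`
    have hset : {v : TangentSpace 𝓘(ℝ, E) x | mfderiv 𝓘(ℝ, E) 𝓘(ℝ, Fin (2 * p) → ℝ)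
        ((L : B.Fiber → (Fin (2 * p) → ℝ)) ∘ B.inFrame x s) x v = 0} =
        {v | B.nablaAt D s x v = 0} := Set.ext fun v ↦ hker v
    rw [hset]
    exact B.hasJDefectLE_ker_nablaAt g hκ hη R hR hRle hbar

variable {B} in
omit [IsManifold 𝓘(ℝ, E) ∞ M] in
/-- `Cⁿ` sections are `Cᵐ` for `m ≤ n`. [folklore] -/
theorem IsContMDiffSection.of_le {m n : WithTop ℕ∞} {s : ∀ x, B.V x}
    (hs : B.IsContMDiffSection n s) (hmn : m ≤ n) : B.IsContMDiffSection m s :=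
  fun x₀ ↦ (hs x₀).of_le hmn

/-- **Zero sets of asymptotically holomorphic, uniformly transverse sequences are nearly
holomorphic cycle supports with empty bad set and defect `O(ε_k)`** (given their connectedness —
the asymptotic Lefschetz hyperplane theorem, [Auroux1997, Prop. 2], not proved here): if the
bundles `B k` have rank `p`, `s` is asymptotically holomorphic with rate `ε` and `η`-transverse for
all large `k` (`η > 0`), then there is `C` such that for all large `k`, whenever `Z(s_k)` is
connected it is an `IsNearlyHolomorphicCycleSupport g p (2Cε_k/η) (Z(s_k)) ∅` — closed
(`isClosed_zeroSet`), and a nearly holomorphic regular point of itself of codimension `p` and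
defect `≤ 2Cε_k/η` at each of its points (`isNearlyHolomorphicRegularPoint_zeroSet`). Auroux:
"the zero sets `W_k` of `s_k` are embedded symplectic submanifolds in `X`. Furthermore, the
submanifolds `W_k` are asymptotically `J`-holomorphic, i.e. `J(TW_k)` is within `O(k^{-1/2})` of
`TW_k`" (here `O(ε_k)`; symplecticity is not recorded). [cite: Auroux1997, Prop. 1] -/
theorem IsAsymptoticallyHolomorphicSequence.isNearlyHolomorphicCycleSupport_zeroSet
    {B : ℕ → SmoothHermitianBundle E M} {D : ∀ k, UnitaryConnection E (B k).Fiber (B k).metric}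
    {g : RiemannianMetric (fun x : M ↦ TangentSpace 𝓘(ℝ, E) x)} {ε : ℕ → ℝ}
    {s : ∀ k x, (B k).V x} {η : ℝ} {p : ℕ} (hAH : IsAsymptoticallyHolomorphicSequence B D g ε s)
    (hη : 0 < η) (hT : ∀ᶠ k : ℕ in atTop, (B k).IsEtaTransverse (D k) g k η (s k))
    (hp : ∀ k, (B k).rank = p) :
    ∃ C : ℝ, ∀ᶠ k : ℕ in atTop, IsConnected ((B k).zeroSet (s k)) →
      IsNearlyHolomorphicCycleSupport g p (2 * (C * ε k) / η) ((B k).zeroSet (s k)) ∅ := by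
  obtain ⟨C, hC⟩ := hAH.exists_hasAHFirstOrderBounds
  refine ⟨C, ?_⟩
  filter_upwards [hC, hT, eventually_gt_atTop 0] with k hk hTk hk0 hconn
  refine isNearlyHolomorphicCycleSupport_empty_iff.2
    ⟨(B k).isClosed_zeroSet (hAH.isContMDiffSection k), hconn, fun x hx ↦ ?_⟩
  have hx0 : s k x = 0 := hx
  have hsx : (B k).hnormSq x (s k x) < η ^ 2 := by
    rw [hx0, hnormSq_zero]
    positivity
  obtain ⟨R, hR, hRle⟩ := hTk x hsx
  exact (B k).isNearlyHolomorphicRegularPoint_zeroSet g (hp k)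
    ((hAH.isContMDiffSection k).of_le (by exact_mod_cast le_top)) hx0 (by exact_mod_cast hk0) hη
    R hR hRle (hk.2.2 x)

end SmoothHermitianBundle

end Sections

end Literature.Geometry.Kaehler
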